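/-
HONEST FRAMING: certified error envelopes and provably optimal rounding/accumulation schemes for
low-precision formats under stated cost models; every table by two implementations; no hardware or
vendor claims.
-/
import Summits.Ventures.CertifiedArithmetic.LowPrec.OptChainLabelsDR
import Summits.Ventures.CertifiedArithmetic.LowPrec.OptChainLabelsRNEConverse

/-!
# Double-rounded summation of NARROW data through a format at least twice as wide:
# the constant collapses to `1 + m u_p` (OPTIMA.md §B, T9(c)/(g), the `q ≥ 2p` regime)

T9(c): `acc + Σ a_i ≤ (1 + m(u_q + u_p)) · r_m` for `r ← RN_p(RN_q(r + a_i))` over nonnegative grid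
data, attained with data in `F(q)`.  Certificate C21 (g) observed that when the data are confined
to the NARROW format `F(p)` (the literal hypothesis of Martin-Dorel–Melquiond–Muller 2013) and
`q ≥ 2p`, the worst case collapses to T4(d)'s `1 + m u_p` on every row — one step beyond the
innocuous-double-rounding range `q ≥ 2p + 1`.  This file proves it for every `m`, all `p ≥ 1`,
all `q ≥ 2p` and ANY nearest maps (any tie rules):

* `drPair_loss_le` — a double-rounded addition of two nonnegative `p`-bit floats loses at most
  `u_p ufp` (not `(u_q + u_p) ufp`): both operands are candidates for both roundings, so the loss
  is at most the smaller operand; and if both operands exceed `u_p ufp = 2^(K-p)` their sum is a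
  multiple of `2^(K+1-2p)` below `2^(K+1)`, hence EXACT in `F(q)`, `q ≥ 2p`, and only the narrow
  rounding loses anything;
* `exact_le_doubleRounding_narrow` — `acc + Σ a_i ≤ (1 + m u_p) · r_m`;
* `doubleRounding_narrow_attained` — attained for every `m` (`q ≥ p + 1`, ties-to-even at the
  binade points): `acc = 2^e`, `a_i = u_p 2^e ∈ F(p)`.
Packaged as `R4_DoubleRoundingNarrowData_holds`.
-/

namespace Summit.Ventures.CertifiedArithmetic.LowPrec.Opt

open Literature.ComputerArithmetic.JeannerodRump2018

/-! ## One double-rounded addition of narrow data -/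

/-- A DOUBLE-ROUNDED ADDITION OF NARROW DATA LOSES AT MOST `u_p · ufp`: for `r, a ∈ F(p)`
nonnegative, any nearest maps `flq` into `F(q)`, `q ≥ 2p`, and `flp` into `F(p)`, followed by an
admissible chain with final value `< 2^(K+1)`:  `r + a - flp (flq (r + a)) ≤ u_p 2^K`. -/
theorem drPair_loss_le {p q : ℕ} (hp1 : 1 ≤ p) (hq : 2 * p ≤ q) {emin : ℤ} {flq flp : ℚ → ℚ}
    (hflq : IsRoundNearest q emin flq) (hflp : IsRoundNearest p emin flp)
    {r a : ℚ} (hr : IsFloat p emin r) (ha : IsFloat p emin a) (hr0 : 0 ≤ r) (ha0 : 0 ≤ a)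
    {ss : List LStep} (hss : ∀ t ∈ ss, t.OK emin) {K : ℤ}
    (hK : lchainEval (flp (flq (r + a))) ss < (2 : ℚ) ^ (K + 1)) :
    r + a - flp (flq (r + a)) ≤ unitRoundoff p * (2 : ℚ) ^ K := by
  have h2 : (2 : ℚ) ≠ 0 := by norm_num
  have hpq : p ≤ q := by omega
  have hrq : IsFloat q emin r := PTree.isFloat_mono hpq hr
  have haq : IsFloat q emin a := PTree.isFloat_mono hpq ha
  -- both operands are candidates for both roundings
  have hm_r : r ≤ flq (r + a) := le_fl_of_isFloat_le hflq hrq (by linarith)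
  have hm_a : a ≤ flq (r + a) := le_fl_of_isFloat_le hflq haq (by linarith)
  have hw_r : r ≤ flp (flq (r + a)) := le_fl_of_isFloat_le hflp hr hm_r
  have hw_a : a ≤ flp (flq (r + a)) := le_fl_of_isFloat_le hflp ha hm_a
  have hupos : 0 < unitRoundoff p * (2 : ℚ) ^ K :=
    mul_pos (by unfold unitRoundoff; positivity) (zpow_pos (by norm_num) _)
  by_cases hrs : r ≤ unitRoundoff p * (2 : ℚ) ^ K
  · linarith
  by_cases has : a ≤ unitRoundoff p * (2 : ℚ) ^ K
  · linarith
  push Not at hrs has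
  rw [mul_comm, two_zpow_mul_unitRoundoff] at hrs has
  -- the narrow rounding alone loses at most `u_p 2^K`
  have hm0 : 0 ≤ flq (r + a) := le_trans hr0 hm_r
  have hmG : IsGrid emin (flq (r + a)) := isGrid_of_isFloat (hflq _).1
  have hnarrow := (step_anatomy hp1 hflp hm0 hmG hss hK).1
  -- and the wide rounding is exact: `r + a ∈ F(q)`
  have hVG : IsGrid emin (r + a) := (isGrid_of_isFloat hr).add (isGrid_of_isFloat ha)
  have hV0 : 0 ≤ r + a := by linarith
  have hVF : IsFloat q emin (r + a) := by
    by_cases hsm : r + a < (2 : ℚ) ^ (emin + q)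
    · exact hVG.isFloat_of_lt hV0 hsm
    have hbig : (2 : ℚ) ^ (emin + q) ≤ r + a := not_lt.mp hsm
    have hrpos : 0 < r := lt_of_le_of_lt (zpow_pos (by norm_num) _).le hrs
    -- `emin ≤ K + 1` and all three values are `< 2^(K+1)` (powers of two propagate)
    have hwpos : 0 < flp (flq (r + a)) := lt_of_lt_of_le hrpos hw_r
    have hKe : emin ≤ K + 1 := by
      by_contra hlt
      push Not at hlt
      have h1 : (2 : ℚ) ^ emin ≤ flp (flq (r + a)) :=
        (isGrid_of_isFloat (hflp _).1).zpow_le_of_pos hwpos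
      have h3 := zpow_le_lchainEval ss _ hss le_rfl h1
      have h4 : (2 : ℚ) ^ (K + 1) < (2 : ℚ) ^ emin := zpow_lt_zpow_right₀ (by norm_num) hlt
      linarith
    have hw_lt : flp (flq (r + a)) < (2 : ℚ) ^ (K + 1) := by
      by_contra hle
      push Not at hle
      have := zpow_le_lchainEval ss _ hss hKe hle
      linarith
    have hm_lt : flq (r + a) < (2 : ℚ) ^ (K + 1) := by
      by_contra hle
      push Not at hle
      have := le_fl_of_isFloat_le hflp (PTree.isFloat_two_zpow hp1 hKe) hle
      linarith
    have hV_lt : r + a < (2 : ℚ) ^ (K + 1) := by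
      by_contra hle
      push Not at hle
      have := le_fl_of_isFloat_le hflq (PTree.isFloat_two_zpow (by omega) hKe) hle
      linarith
    have heK : emin + q ≤ K := by
      by_contra hlt
      have : (2 : ℚ) ^ (K + 1) ≤ (2 : ℚ) ^ (emin + (q : ℤ)) :=
        zpow_le_zpow_right₀ (by norm_num) (by omega)
      linarith
    obtain ⟨kr, hkr⟩ := IsFloat.exists_int_mul_zpow hr hrs.le
    obtain ⟨ka, hka⟩ := IsFloat.exists_int_mul_zpow ha has.le
    have hcpos : (0 : ℚ) < (2 : ℚ) ^ (K - p + 1 - p) := zpow_pos (by norm_num) _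
    have hsum : r + a = ((kr + ka : ℤ) : ℚ) * (2 : ℚ) ^ (K - p + 1 - p) := by
      rw [hkr, hka]; push_cast; ring
    refine ⟨kr + ka, K - p + 1 - p, ?_, by omega, hsum⟩
    have hk0 : (0 : ℚ) ≤ ((kr + ka : ℤ) : ℚ) := by
      have : (0 : ℚ) ≤ ((kr + ka : ℤ) : ℚ) * (2 : ℚ) ^ (K - p + 1 - p) := by rw [← hsum]; exact hV0
      exact nonneg_of_mul_nonneg_left this hcpos
    have hk1 : ((kr + ka : ℤ) : ℚ) < (2 : ℚ) ^ (q : ℤ) := by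
      have h5 : ((kr + ka : ℤ) : ℚ) * (2 : ℚ) ^ (K - p + 1 - p) <
          (2 : ℚ) ^ ((2 * p : ℕ) : ℤ) * (2 : ℚ) ^ (K - p + 1 - p) := by
        rw [← hsum, ← zpow_add₀ h2, show ((2 * p : ℕ) : ℤ) + (K - p + 1 - p) = K + 1 by
          push_cast; ring]
        exact hV_lt
      have h6 := lt_of_mul_lt_mul_right h5 hcpos.le
      exact lt_of_lt_of_le h6 (zpow_le_zpow_right₀ (by norm_num) (by exact_mod_cast hq))
    rw [zpow_natCast] at hk1
    have hk0' : 0 ≤ kr + ka := by exact_mod_cast hk0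
    have hk1' : kr + ka < (2 : ℤ) ^ q := by exact_mod_cast hk1
    rw [abs_of_nonneg hk0']; exact hk1'
  rw [fl_eq_self hflq hVF] at hnarrow ⊢
  exact hnarrow

/-! ## The chain -/

/-- CHAIN DEFICIT for narrow data (`q ≥ 2p`): `acc + Σ a_i - r_m ≤ m · u_p 2^K` whenever
`r_m < 2^(K+1)`, for `acc, a_i ∈ F(p)` nonnegative and any nearest maps. -/
theorem dr_deficit_le_narrow {p q : ℕ} (hp1 : 1 ≤ p) (hq : 2 * p ≤ q) {emin : ℤ}
    {flq flp : ℚ → ℚ} (hflq : IsRoundNearest q emin flq) (hflp : IsRoundNearest p emin flp) :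
    ∀ (ys : List ℚ) (acc : ℚ), 0 ≤ acc → IsFloat p emin acc →
      (∀ y ∈ ys, 0 ≤ y ∧ IsFloat p emin y) → ∀ K : ℤ,
        lchainEval acc (drSteps q p flq flp ys) < (2 : ℚ) ^ (K + 1) →
          acc + ys.sum - lchainEval acc (drSteps q p flq flp ys) ≤
            (ys.length : ℚ) * (unitRoundoff p * (2 : ℚ) ^ K)
  | [], acc, _, _, _, K, _ => by simp
  | y :: ys, acc, hacc0, haccF, hys, K, hK => by
      obtain ⟨hy0, hyF⟩ := hys y (by simp)
      have hrest : ∀ z ∈ ys, 0 ≤ z ∧ IsFloat p emin z := fun z hz => hys z (by simp [hz])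
      have hssOK : ∀ t ∈ drSteps q p flq flp ys, t.OK emin :=
        drSteps_ok (by omega) hp1 hflq hflp ys (fun z hz => ⟨(hrest z hz).1, isGrid_of_isFloat (hrest z hz).2⟩)
      rw [drSteps_cons, lchainEval_cons, lchainEval_cons] at hK ⊢
      simp only [add_zero] at hK ⊢
      have hw0 : 0 ≤ flp (flq (acc + y)) :=
        le_fl_of_isFloat_le hflp (isFloat_zero _ _)
          (le_fl_of_isFloat_le hflq (isFloat_zero _ _) (by linarith))
      have ih := dr_deficit_le_narrow hp1 hq hflq hflp ys _ hw0 (hflp _).1 hrest K hK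
      have hpair := drPair_loss_le hp1 hq hflq hflp haccF hyF hacc0 hy0 hssOK hK
      rw [List.sum_cons, List.length_cons]
      push_cast
      linarith

/-- A double-rounding chain of nonnegative narrow data computes `0` only from zero data. -/
theorem dr_eq_zero_narrow {p q : ℕ} (hp1 : 1 ≤ p) (hq : 1 ≤ q) {emin : ℤ}
    {flq flp : ℚ → ℚ} (hflq : IsRoundNearest q emin flq) (hflp : IsRoundNearest p emin flp)
    (ys : List ℚ) (acc : ℚ) (hacc0 : 0 ≤ acc) (haccF : IsFloat p emin acc)
    (hys : ∀ y ∈ ys, 0 ≤ y ∧ IsFloat p emin y)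
    (h0 : lchainEval acc (drSteps q p flq flp ys) = 0) : acc + ys.sum = 0 := by
  have h := lchainEval_eq_zero (drSteps q p flq flp ys) acc hacc0 (isGrid_of_isFloat haccF)
    (drSteps_ok hq hp1 hflq hflp ys (fun z hz => ⟨(hys z hz).1, isGrid_of_isFloat (hys z hz).2⟩)) h0
  rwa [xsum_drSteps] at h

/-- DOUBLE-ROUNDED SUMMATION OF NARROW DATA, `q ≥ 2p` (T9(c)/(g)): for `acc, a_i ∈ F(p)`
nonnegative and ANY nearest maps into `F(q)` and `F(p)`,  `acc + Σ a_i ≤ (1 + m u_p) · r_m` — the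
wide roundings cost nothing in the worst case. -/
theorem exact_le_doubleRounding_narrow {p q : ℕ} (hp1 : 1 ≤ p) (hq : 2 * p ≤ q) {emin : ℤ}
    {flq flp : ℚ → ℚ} (hflq : IsRoundNearest q emin flq) (hflp : IsRoundNearest p emin flp)
    (ys : List ℚ) (acc : ℚ) (hacc0 : 0 ≤ acc) (haccF : IsFloat p emin acc)
    (hys : ∀ y ∈ ys, 0 ≤ y ∧ IsFloat p emin y) :
    acc + ys.sum ≤ (1 + (ys.length : ℚ) * unitRoundoff p) *
      lchainEval acc (drSteps q p flq flp ys) := by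
  set c := lchainEval acc (drSteps q p flq flp ys) with hc
  have hysG : ∀ y ∈ ys, 0 ≤ y ∧ IsGrid emin y :=
    fun z hz => ⟨(hys z hz).1, isGrid_of_isFloat (hys z hz).2⟩
  have hc0 : 0 ≤ c :=
    lchainEval_nonneg (drSteps q p flq flp ys) acc hacc0 (drSteps_ok (by omega) hp1 hflq hflp ys hysG)
  have hm0 : (0 : ℚ) ≤ (ys.length : ℚ) * unitRoundoff p :=
    mul_nonneg (by positivity) (unitRoundoff_nonneg p)
  rcases eq_or_lt_of_le hc0 with hzero | hpos
  · have h := dr_eq_zero_narrow hp1 (by omega) hflq hflp ys acc hacc0 haccF hys hzero.symm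
    rw [h, ← hzero]; simp
  · set K := Int.log 2 c with hK
    have hlow : ((2 : ℕ) : ℚ) ^ K ≤ c := Int.zpow_log_le_self (by norm_num) hpos
    have hupK : c < ((2 : ℕ) : ℚ) ^ (K + 1) := Int.lt_zpow_succ_log_self (by norm_num) _
    push_cast at hlow hupK
    have hdef := dr_deficit_le_narrow hp1 hq hflq hflp ys acc hacc0 haccF hys K hupK
    have h1 : (ys.length : ℚ) * (unitRoundoff p * (2 : ℚ) ^ K) ≤
        (ys.length : ℚ) * (unitRoundoff p * c) :=
      mul_le_mul_of_nonneg_left (mul_le_mul_of_nonneg_left hlow (unitRoundoff_nonneg p))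
        (by positivity)
    have h3 : (1 + (ys.length : ℚ) * unitRoundoff p) * c =
        c + (ys.length : ℚ) * (unitRoundoff p * c) := by ring
    linarith

/-! ## Sharpness with narrow data -/

/-- The `p`-midpoint `2^e (1 + u_p) = (2^p + 1) 2^(e-p)` is a float of `F(q)`, `q ≥ p + 1`. -/
theorem isFloat_midpoint_wide {p q : ℕ} (hp1 : 1 ≤ p) (hpq : p + 1 ≤ q) {emin e : ℤ}
    (he : emin + p ≤ e) :
    IsFloat q emin ((2 : ℚ) ^ e + (2 : ℚ) ^ e * unitRoundoff p) := by
  have h2 : (2 : ℚ) ≠ 0 := by norm_num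
  refine ⟨2 ^ p + 1, e - p, ?_, by omega, ?_⟩
  · rw [abs_of_pos (by positivity)]
    have h1 : (2 : ℤ) ^ (p + 1) ≤ 2 ^ q := pow_le_pow_right₀ (by norm_num) hpq
    have h3 : (1 : ℤ) < 2 ^ p := one_lt_pow₀ (by norm_num) (by omega)
    rw [pow_succ] at h1
    omega
  · rw [two_zpow_mul_unitRoundoff]
    push_cast
    rw [add_mul, one_mul, ← zpow_natCast, ← zpow_add₀ h2]
    congr 2
    ring

/-- THE NARROW WITNESS NEVER MOVES: accumulator `2^e`, summands `u_p 2^e ∈ F(p)`; the wide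
rounding of `2^e (1 + u_p)` is exact (`q ≥ p + 1`) and the narrow one resolves the binade
midpoint to `2^e` (`TiesEvenAtPow`). -/
theorem lchainEval_drNarrowWitness {p q : ℕ} (hp1 : 1 ≤ p) (hpq : p + 1 ≤ q) {emin : ℤ}
    {flq flp : ℚ → ℚ}
    (hflq : IsRoundNearest q emin flq) (hE : TiesEvenAtPow p emin flp) {e : ℤ}
    (he : emin + p ≤ e) :
    ∀ m : ℕ, lchainEval ((2 : ℚ) ^ e)
      (drSteps q p flq flp (List.replicate m ((2 : ℚ) ^ e * unitRoundoff p))) = (2 : ℚ) ^ e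
  | 0 => by simp
  | m + 1 => by
      rw [List.replicate_succ, drSteps_cons, lchainEval_cons, lchainEval_cons]
      dsimp only
      rw [fl_eq_self hflq (isFloat_midpoint_wide hp1 hpq he), add_zero, hE e (by omega)]
      exact lchainEval_drNarrowWitness hp1 hpq hflq hE he m

/-- NARROW-DATA SHARPNESS (T9(c)/(g)): with `acc = 2^e` and `m` summands `u_p 2^e`, all in
`F(p)`, `2^e + Σ a_i = (1 + m u_p) · r_m`, `r_m = 2^e` — so for `q ≥ 2p` the worst case over
narrow data is EXACTLY `1 + m u_p`, and for `p + 1 ≤ q` it is at least that. -/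
theorem doubleRounding_narrow_attained {p q : ℕ} (hp1 : 1 ≤ p) (hpq : p + 1 ≤ q) {emin : ℤ}
    {flq flp : ℚ → ℚ} (hflq : IsRoundNearest q emin flq) (hE : TiesEvenAtPow p emin flp)
    {e : ℤ} (he : emin + p ≤ e) (m : ℕ) :
    let ys := List.replicate m ((2 : ℚ) ^ e * unitRoundoff p)
    (∀ y ∈ ys, 0 ≤ y ∧ IsFloat p emin y) ∧ IsFloat p emin ((2 : ℚ) ^ e) ∧
    lchainEval ((2 : ℚ) ^ e) (drSteps q p flq flp ys) = (2 : ℚ) ^ e ∧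
    (2 : ℚ) ^ e + ys.sum = (1 + (m : ℚ) * unitRoundoff p) *
      lchainEval ((2 : ℚ) ^ e) (drSteps q p flq flp ys) := by
  intro ys
  have hc := lchainEval_drNarrowWitness hp1 hpq hflq hE he m
  refine ⟨fun y hy => ?_, PTree.isFloat_two_zpow hp1 (by omega), hc, ?_⟩
  · rw [List.eq_of_mem_replicate hy]
    exact ⟨mul_nonneg (zpow_pos (by norm_num) _).le (unitRoundoff_nonneg p),
      isFloat_zpow_mul_unitRoundoff hp1 he⟩
  · rw [hc]
    simp only [ys, List.sum_replicate, nsmul_eq_mul]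
    ring

/-! ## Registered form -/

/-- DOUBLE-ROUNDED SUMMATION OF NARROW DATA (OPTIMA.md §B, T9(c)/(g); certificate C21 (g), rows
`q ≥ 2p`): (1) for `q ≥ 2p`, `p ≥ 1`, ANY nearest maps into `F(q)` and `F(p)`, `acc, a_i ∈ F(p)`
nonnegative: `acc + Σ a_i ≤ (1 + m u_p) · r_m` — the labelled-chain constant `1 + m(u_q+u_p)`
collapses to T4(d)'s; (2) attained for every `m` as soon as `q ≥ p + 1`, under any nearest map
into `F(q)` and any nearest map into `F(p)` with ties-to-even at the binade points (which exist). -/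
def R4_DoubleRoundingNarrowData : Prop :=
  (∀ (p q : ℕ) (emin : ℤ) (flq flp : ℚ → ℚ), 1 ≤ p → 2 * p ≤ q →
    IsRoundNearest q emin flq → IsRoundNearest p emin flp →
    ∀ (acc : ℚ) (ys : List ℚ), 0 ≤ acc → IsFloat p emin acc →
      (∀ y ∈ ys, 0 ≤ y ∧ IsFloat p emin y) →
      acc + ys.sum ≤ (1 + (ys.length : ℚ) * unitRoundoff p) *
        lchainEval acc (drSteps q p flq flp ys)) ∧
  (∀ (p q : ℕ) (emin : ℤ) (flq flp : ℚ → ℚ), 1 ≤ p → p + 1 ≤ q →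
    IsRoundNearest q emin flq → TiesEvenAtPow p emin flp →
    ∀ (e : ℤ) (m : ℕ), emin + p ≤ e →
      lchainEval ((2 : ℚ) ^ e) (drSteps q p flq flp
          (List.replicate m ((2 : ℚ) ^ e * unitRoundoff p))) = (2 : ℚ) ^ e ∧
      (2 : ℚ) ^ e + (List.replicate m ((2 : ℚ) ^ e * unitRoundoff p)).sum =
        (1 + (m : ℚ) * unitRoundoff p) * (2 : ℚ) ^ e) ∧
  (∀ (p : ℕ) (emin : ℤ), 1 ≤ p → ∃ fl : ℚ → ℚ, IsRoundNearest p emin fl ∧ TiesEvenAtPow p emin fl)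

/-- `R4_DoubleRoundingNarrowData` holds. -/
theorem R4_DoubleRoundingNarrowData_holds : R4_DoubleRoundingNarrowData := by
  refine ⟨?_, ?_, fun p emin hp => exists_roundNearest_tiesEven hp emin⟩
  · intro p q emin flq flp hp1 hq hflq hflp acc ys hacc0 haccF hys
    exact exact_le_doubleRounding_narrow hp1 hq hflq hflp ys acc hacc0 haccF hys
  · intro p q emin flq flp hp1 hpq hflq hE e m he
    obtain ⟨-, -, hc, heq⟩ := doubleRounding_narrow_attained hp1 hpq hflq hE he m
    exact ⟨hc, by rw [heq, hc]⟩

end Summit.Ventures.CertifiedArithmetic.LowPrec.Opt
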